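import Literature.Analysis.TotalPositivity.PolyaFrequencyZeros
import Literature.Analysis.Complex.HadamardGenusZeroProofs
import HarnessLib

/-!
# Pólya frequency Taylor sequences of entire functions of order `< 1` — discharge

Trunk T-ANALYSIS (Literature/Analysis/TotalPositivity). This file DISCHARGES the named fact
`Literature.Analysis.TotalPositivity.pf_taylor_iff_zeros_of_order_lt_one` (`PolyaFrequency.lean`,
[Karlin 1968, Ch. 8, Thm. 5.3]; the entire case of the Aissen–Edrei–Schoenberg–Whitney
representation theorem [AESW 1951, Thm. 5, p. 306]: an entire `f = Σ aₙ zⁿ`, `a₀ = 1`, generates a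
totally positive sequence iff `f(z) = e^{γz} ∏ (1 + α_ν z)`, `γ ≥ 0`, `α_ν ≥ 0`, `Σ α_ν < ∞`;
for order `< 1` the factor `e^{γz}` is absent and the condition reads "all zeros `-1/α_ν` are real
and `≤ 0`"):

for an entire `F` of order `< 1` with real Taylor coefficients at `0` and `F(0) > 0`, the Taylor
sequence `(F⁽ⁿ⁾(0)/n!)ₙ` is a Pólya frequency sequence iff every zero of `F` is real and `≤ 0`.

Nothing new is proved here: the discharge is the composition of two results already in the tree,
* `Literature.Analysis.TotalPositivity.pf_taylor_iff_zeros_of_order_lt_one_of_hadamard :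
  Literature.Analysis.Complex.hadamard_genus_zero → pf_taylor_iff_zeros_of_order_lt_one`
  (`PolyaFrequencyZeros.lean`, C10: `⇐` = finite products of the PF sequences `(1, αᵢ, 0, …)` and
  limits, `PolyaFrequencyEntire.lean`; `⇒` = the `1/f(-z)` closure rule, the positivity trick and
  pole deflation, `PolyaFrequencyDeflation.lean` / `PolyaFrequencyZeros.lean`), and
* `Literature.Analysis.Complex.hadamard_genus_zero_holds : hadamard_genus_zero`
  (`HadamardGenusZeroProofs.lean`, [Conway 1978, Ch. XI, Thm. 3.4] in genus `0`).

It lives in a sibling file because `PolyaFrequency.lean` is imported by every other file of this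
directory (appending the discharge there would close an import cycle).

## References

* M. Aissen, A. Edrei, I. J. Schoenberg, A. Whitney, *On the generating functions of totally
  positive sequences*, Proc. Nat. Acad. Sci. USA 37 (1951) 303–307, Thm. 5 (p. 306).
* S. Karlin, *Total Positivity. Vol. I*, Stanford UP 1968, Ch. 8, Thm. 5.3.
* J. B. Conway, *Functions of One Complex Variable I*, 2nd ed., GTM 11, Springer 1978, Ch. XI,
  Thm. 3.4.
* S. M. Fallat, C. R. Johnson, *Totally Nonnegative Matrices*, Princeton UP 2011, §0.1 (p. 16:
  the representation theorem).
-/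

noncomputable section

namespace Literature.Analysis.TotalPositivity

/-- **Discharge of `pf_taylor_iff_zeros_of_order_lt_one`** ([Karlin 1968, Ch. 8, Thm. 5.3];
[Aissen–Edrei–Schoenberg–Whitney 1951, Thm. 5] restricted to order `< 1`): for an entire `F` of
order `< 1` with real Taylor coefficients and `F(0) > 0`, `(F⁽ⁿ⁾(0)/n!)ₙ` is a Pólya frequency
sequence iff all zeros of `F` are real and `≤ 0`. Proof: Hadamard's genus-zero factorisation
(`Literature.Analysis.Complex.hadamard_genus_zero_holds`) fed into
`pf_taylor_iff_zeros_of_order_lt_one_of_hadamard`. [cite: Karlin1968, Ch. 8 Thm. 5.3] -/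
theorem pf_taylor_iff_zeros_of_order_lt_one_holds : pf_taylor_iff_zeros_of_order_lt_one :=
  pf_taylor_iff_zeros_of_order_lt_one_of_hadamard
    Literature.Analysis.Complex.hadamard_genus_zero_holds

end Literature.Analysis.TotalPositivity
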